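import Mathlib
import HarnessLib
import Summits.HubbardSuperconductivity.HubbardSuperconductivity.Theorems.KLProgrammeKLRegimeThinPairDiffTwoScale
import Summits.HubbardSuperconductivity.HubbardSuperconductivity.Theorems.KLProgrammeH10TwoPointLimitFrameSectorCell
import Summits.HubbardSuperconductivity.HubbardSuperconductivity.Theorems.KLProgrammeKLRegimeSplitTwoLegReadingSlopes
import Summits.HubbardSuperconductivity.HubbardSuperconductivity.Theorems.KLProgrammeKLRegimeSliceTangencyBridge
import Summits.HubbardSuperconductivity.HubbardSuperconductivity.Theorems.KLProgrammeKLRegimeIntegerTangentNorm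
import Summits.HubbardSuperconductivity.HubbardSuperconductivity.Theorems.KLProgrammeKLRegimeSectorSliceIncrRates
import Summits.HubbardSuperconductivity.HubbardSuperconductivity.Theorems.KLProgrammeKLRegimeFrameBandPi

/-!
# K3 VL child `KLRegimeVolumeLimitV17F2` (stmt-HubbardSuperconductivity-20440), located item #23 «W2-HALF-VL», brick «W2H-OVL» part 16 (TANGENT DATA):
# the integer tangent step of the thin pair `(k+1, ω′; k, a′)` across two frames — tangency at `p_F^K(θ_{k,a′})`, and EITHER the thin-pair frame difference
# vanishes identically OR the transported tangency at `p_F^{K′}(θ_{k+1,ω′})`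

Cell `gate-hubbard-kl`, seat p3 (g15), lead of #23.  The per-piece lemma `charSumWt_thinPairDiff_le_twoScale` (part 14) takes ONE integer step `v` with
`|v_j| ≤ N_r + ½`, `|v| ≥ N_r − 1`, tangency `T₁` at `p_F^K(θ_{k,a′})` on the base frame `K` and `T₂` at `p_F^{K′}(θ_{k+1,ω′})` on the second frame `K′`.
Here `v = round(N_r·t̂)` with `t̂` the unit tangent of `e_K` at `p_F^K(θ_{k,a′})` (`tangentStep_bounds`, `T₁ = 4 + 2A`), and the second tangency is
TRANSPORTED: if the difference `F^{K′}_{ω′}F^{K′}_{a′} − F^{K}_{ω′}F^{K}_{a′}` is not identically zero, one of the two products is nonzero somewhere, so on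
ONE frame the support cells of the two sectors meet (`support_klAnisoFamily_cell`) and `‖p_F^{K′}(θ_{k+1,ω′}) − p_F^K(θ_{k,a′})‖ ≤ ρ_k + ρ_{k+1} + fd/(Dt_min−2A)`
(`ρ_n = (Λ_n + s_max Dt_min·3w_n/4)/(Dt_min − 2A)`, `frameDist K K′ ≤ fd`, `norm_klFermiPoint_sub_le_frameDist`); then
`abs_fderiv_frameLevel_toLp_le_of_near` (curvature `K₂` of `e_K`) and `‖Dν‖ ≤ G₁ₓ` (`ν = e_K − e_{K′}` on the Pi side) give
`T₂ = (4+2A) + (2K₂·(ρ_k + ρ_{k+1} + fd/(Dt_min−2A)) + G₁ₓ)·(N_r + ½)`.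

* **`thinPair_tangent_data`** — `∃ v`, the four facts, the last as a disjunction «`D ≡ 0` ∨ tangency `T₂`».

Everything is proved; no definitions, no sorry.  Nothing asserts any stub, K3, VL or superconductivity. [cite: BenfattoGiulianiMastropietro2006, §2.7 (2.69), §3 (3.2)–(3.8)]
-/

noncomputable section

namespace Summit.HubbardSuperconductivity.HubbardSuperconductivity.Theorems.TorusFourierL2

set_option linter.dupNamespace false -- summit = problem name (single-conjunct summit), D-0017

open Set Finset Filter Topology Literature.MathematicalPhysics.QuantumLattice Literature.MathematicalPhysics.QuantumLattice.BandSectorCounting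
open Literature.MathematicalPhysics.QuantumLattice.FermiRG Literature.Probability.LatticeModels Literature.Analysis.SpecialFunctions Literature.Analysis.Calculus
open Summit.HubbardSuperconductivity.HubbardSuperconductivity.Theorems.DispersionFlow
open Summit.HubbardSuperconductivity.HubbardSuperconductivity.Theorems.KLRegimeSplit
open Summit.HubbardSuperconductivity.HubbardSuperconductivity.Theorems.KLProgrammeLegKernels
open Summit.HubbardSuperconductivity.HubbardSuperconductivity.Theorems.PerturbedFermiCurve
open scoped Real Nat

open Classical

set_option maxHeartbeats 1600000 in
/-- **The integer tangent step of a thin pair across two frames, with the transported second tangency** (see the module docstring).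
[cite: BenfattoGiulianiMastropietro2006, §2.7 (2.69), §3 (3.2)–(3.8)] -/
theorem thinPair_tangent_data {L M : ℕ} [NeZero L] [NeZero M] {a b : ℝ} (B : BandBounds a b) {K K' : TrigPolyC4v} {A : ℝ}
    (hA : ∀ p : Momentum, ∀ j ≤ 2, ‖iteratedFDeriv ℝ j (frameShift K) p‖ ≤ A)
    (hA' : ∀ p : Momentum, ∀ j ≤ 2, ‖iteratedFDeriv ℝ j (frameShift K') p‖ ≤ A)
    (hADt : 2 * A < B.Dtmin) {μ e₀ : ℝ} (he : 0 < e₀) (hlo : a ≤ μ - A - e₀) (hhi : μ + A + e₀ ≤ b) (hρA : 4 * A < 2 * B.rhomin)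
    (β : ℝ) (k : ℕ) {K₂ : ℝ} (hK₂ : ∀ p, ‖iteratedFDeriv ℝ 2 (frameLevel μ K) p‖ ≤ K₂) {Nr : ℝ} (hNr : 2 ≤ Nr)
    {ν : (Fin 2 → ℝ) → ℝ} (hν : ∀ p, ν p = frameLevel μ K (WithLp.toLp 2 p) - frameLevel μ K' (WithLp.toLp 2 p)) (hνd : Differentiable ℝ ν)
    {G₁x : ℝ} (hN₁ : ∀ p, ‖fderiv ℝ ν p‖ ≤ G₁x) {fd : ℝ} (hfd : frameDist K K' ≤ fd) {T₂ : ℝ}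
    (hT₂ : (4 + 2 * A) + (2 * K₂ * ((klScale e₀ k + B.smax * B.Dtmin * (3 * sectorWidth k / 4)) / (B.Dtmin - 2 * A) +
        (klScale e₀ (k + 1) + B.smax * B.Dtmin * (3 * sectorWidth (k + 1) / 4)) / (B.Dtmin - 2 * A) + fd / (B.Dtmin - 2 * A)) + G₁x) *
        (Nr + 1 / 2) ≤ T₂)
    (ω' : Fin (sectorCount (k + 1))) (a' : Fin (sectorCount k)) :
    ∃ v : Fin 2 → ℤ, (∀ j, |(v j : ℝ)| ≤ Nr + 1 / 2) ∧ Nr - 1 ≤ Real.sqrt ((v 0 : ℝ) ^ 2 + (v 1 : ℝ) ^ 2) ∧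
      |fderiv ℝ (fun p : Fin 2 → ℝ => frameLevel μ K (WithLp.toLp 2 p)) (klFermiPoint μ K (sectorCenter k (a' : ℕ)))
        (fun j => 2 * π / L * (v j : ℝ))| ≤ |2 * π / L| * (4 + 2 * A) ∧
      ((∀ q : TorusSite 1 (2 * M) × TorusSite 2 L,
          klAnisoFamily L M β μ K' e₀ (k + 1) ω' (⟨(q.1 0).val, ZMod.val_lt (q.1 0)⟩, q.2) *
              klAnisoFamily L M β μ K' e₀ k a' (⟨(q.1 0).val, ZMod.val_lt (q.1 0)⟩, q.2) -
            klAnisoFamily L M β μ K e₀ (k + 1) ω' (⟨(q.1 0).val, ZMod.val_lt (q.1 0)⟩, q.2) *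
              klAnisoFamily L M β μ K e₀ k a' (⟨(q.1 0).val, ZMod.val_lt (q.1 0)⟩, q.2) = 0) ∨
        |fderiv ℝ (fun p : Fin 2 → ℝ => frameLevel μ K' (WithLp.toLp 2 p)) (klFermiPoint μ K' (sectorCenter (k + 1) (ω' : ℕ)))
          (fun j => 2 * π / L * (v j : ℝ))| ≤ |2 * π / L| * T₂) := by
  have hL : (0 : ℝ) < L := Nat.cast_pos.2 (Nat.pos_of_ne_zero (NeZero.ne L))
  have hπ := Real.pi_pos
  have habs : |2 * π / (L : ℝ)| = 2 * π / L := abs_of_pos (by positivity)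
  have hlo' : a ≤ μ - A := by linarith only [hlo, he]
  have hhi' : μ + A ≤ b := by linarith only [hhi, he]
  have hA0 : 0 ≤ A := (norm_nonneg _).trans (hA 0 0 (by norm_num))
  have hK20 : 0 ≤ K₂ := (norm_nonneg _).trans (hK₂ 0)
  have hG0 : 0 ≤ G₁x := (norm_nonneg _).trans (hN₁ 0)
  have hDt : 0 < B.Dtmin - 2 * A := by linarith only [hADt]
  have hγ : 0 < 2 * B.rhomin - 4 * A := by linarith only [hρA]
  set θ₁ : ℝ := sectorCenter k (a' : ℕ) with hθ₁
  set θ₂ : ℝ := sectorCenter (k + 1) (ω' : ℕ) with hθ₂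
  set pF₁ : Fin 2 → ℝ := klFermiPoint μ K θ₁ with hpF₁
  set pF₂ : Fin 2 → ℝ := klFermiPoint μ K' θ₂ with hpF₂
  set eK : (Fin 2 → ℝ) → ℝ := fun p => frameLevel μ K (WithLp.toLp 2 p) with heK
  set eK' : (Fin 2 → ℝ) → ℝ := fun p => frameLevel μ K' (WithLp.toLp 2 p) with heK'
  set g₀ : ℝ := fderiv ℝ eK pF₁ (Pi.single 0 1) with hg₀
  set g₁ : ℝ := fderiv ℝ eK pF₁ (Pi.single 1 1) with hg₁
  have hN0 : 0 < Real.sqrt (g₀ ^ 2 + g₁ ^ 2) := lt_of_lt_of_le hγ (gradient_floor_klFermiPoint B hA hlo' hhi' θ₁)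
  -- the integer tangent step at `p_F^K(θ₁)`
  obtain ⟨v, hv⟩ : ∃ v : Fin 2 → ℤ, v = ![round (Nr * (-g₁ / Real.sqrt (g₀ ^ 2 + g₁ ^ 2))), round (Nr * (g₀ / Real.sqrt (g₀ ^ 2 + g₁ ^ 2)))] :=
    ⟨_, rfl⟩
  have hv0 : v 0 = round (Nr * (-g₁ / Real.sqrt (g₀ ^ 2 + g₁ ^ 2))) := by rw [hv]; rfl
  have hv1 : v 1 = round (Nr * (g₀ / Real.sqrt (g₀ ^ 2 + g₁ ^ 2))) := by rw [hv]; rfl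
  have hNr1 : 1 ≤ Nr := by linarith only [hNr]
  obtain ⟨htan, hvj, hvne⟩ := tangentStep_bounds eK pF₁ (norm_fderiv_frameBand_le hA μ pF₁) hN0 hNr1 v hv0 hv1 (2 * π / L)
  have hunit : (-g₁ / Real.sqrt (g₀ ^ 2 + g₁ ^ 2)) ^ 2 + (g₀ / Real.sqrt (g₀ ^ 2 + g₁ ^ 2)) ^ 2 = 1 := by
    have h := (frame_orthonormal hN0).2.1
    rw [neg_div]; exact h
  have hvlen : Nr - 1 ≤ Real.sqrt ((v 0 : ℝ) ^ 2 + (v 1 : ℝ) ^ 2) := by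
    have h := sub_one_le_sqrt_sum_sq_round hNr (u := ![-g₁ / Real.sqrt (g₀ ^ 2 + g₁ ^ 2), g₀ / Real.sqrt (g₀ ^ 2 + g₁ ^ 2)]) hunit
    rw [hv0, hv1]
    exact h
  refine ⟨v, hvj, hvlen, htan, ?_⟩
  -- the step as a Pi vector and as a Euclidean vector
  set w : Fin 2 → ℝ := fun j => 2 * π / L * (v j : ℝ) with hw
  have hNr0 : 0 ≤ Nr + 1 / 2 := by linarith only [hNr]
  have hwsup : ‖w‖ ≤ |2 * π / (L : ℝ)| * (Nr + 1 / 2) := by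
    refine (pi_norm_le_iff_of_nonneg (by positivity)).2 fun j => ?_
    rw [hw, Real.norm_eq_abs, abs_mul]
    exact mul_le_mul_of_nonneg_left (hvj j) (abs_nonneg _)
  have hwE : ‖(WithLp.toLp 2 w : EuclideanSpace ℝ (Fin 2))‖ ≤ 2 * π / L * (Real.sqrt 2 * (Nr + 1 / 2)) := by
    rw [hw, norm_toLp_latticeStep]
    refine mul_le_mul_of_nonneg_left ?_ (by positivity)
    have hsq0 : (v 0 : ℝ) ^ 2 ≤ (Nr + 1 / 2) ^ 2 := by rw [← sq_abs]; exact pow_le_pow_left₀ (abs_nonneg _) (hvj 0) 2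
    have hsq1 : (v 1 : ℝ) ^ 2 ≤ (Nr + 1 / 2) ^ 2 := by rw [← sq_abs]; exact pow_le_pow_left₀ (abs_nonneg _) (hvj 1) 2
    calc Real.sqrt ((v 0 : ℝ) ^ 2 + (v 1 : ℝ) ^ 2) ≤ Real.sqrt (2 * (Nr + 1 / 2) ^ 2) := Real.sqrt_le_sqrt (by linarith only [hsq0, hsq1])
      _ = Real.sqrt 2 * (Nr + 1 / 2) := by rw [Real.sqrt_mul (by norm_num), Real.sqrt_sq hNr0]
  by_cases hex : ∃ q : TorusSite 1 (2 * M) × TorusSite 2 L,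
      klAnisoFamily L M β μ K' e₀ (k + 1) ω' (⟨(q.1 0).val, ZMod.val_lt (q.1 0)⟩, q.2) *
          klAnisoFamily L M β μ K' e₀ k a' (⟨(q.1 0).val, ZMod.val_lt (q.1 0)⟩, q.2) -
        klAnisoFamily L M β μ K e₀ (k + 1) ω' (⟨(q.1 0).val, ZMod.val_lt (q.1 0)⟩, q.2) *
          klAnisoFamily L M β μ K e₀ k a' (⟨(q.1 0).val, ZMod.val_lt (q.1 0)⟩, q.2) ≠ 0
  swap
  · left
    intro q
    by_contra hq
    exact hex ⟨q, hq⟩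
  right
  obtain ⟨q, hq⟩ := hex
  set kk : FreqMomentum L M := (⟨(q.1 0).val, ZMod.val_lt (q.1 0)⟩, q.2) with hkk
  -- the cells: on ONE frame both sectors carry the support point `c`
  set c : Fin 2 → ℝ := torusCentredMomentum L q.2 with hc
  set ρa : ℝ := (klScale e₀ k + B.smax * B.Dtmin * (3 * sectorWidth k / 4)) / (B.Dtmin - 2 * A) with hρa
  set ρb : ℝ := (klScale e₀ (k + 1) + B.smax * B.Dtmin * (3 * sectorWidth (k + 1) / 4)) / (B.Dtmin - 2 * A) with hρb
  have hΛe : ∀ n, klScale e₀ n ≤ e₀ := fun n => klScale_le_e0 he.le n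
  have hloN : ∀ n, a ≤ μ - A - klScale e₀ n := fun n => by linarith only [hlo, hΛe n]
  have hhiN : ∀ n, μ + A + klScale e₀ n ≤ b := fun n => by linarith only [hhi, hΛe n]
  have hfd' : frameDist K K' / (B.Dtmin - 2 * A) ≤ fd / (B.Dtmin - 2 * A) := div_le_div_of_nonneg_right hfd hDt.le
  have hsm := B.smax_pos
  have hDt0 := B.Dtmin_pos
  have hρa0 : 0 ≤ ρa := by
    rw [hρa]
    have h1 : 0 ≤ klScale e₀ k := by rw [klScale]; positivity
    have h2 := sectorWidth_pos k
    exact div_nonneg (by positivity) hDt.le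
  have hρb0 : 0 ≤ ρb := by
    rw [hρb]
    have h1 : 0 ≤ klScale e₀ (k + 1) := by rw [klScale]; positivity
    have h2 := sectorWidth_pos (k + 1)
    exact div_nonneg (by positivity) hDt.le
  -- the distance of the two Fermi points
  have hdist : ‖pF₂ - pF₁‖ ≤ ρa + ρb + fd / (B.Dtmin - 2 * A) := by
    have hcellK : ∀ (Kx : TrigPolyC4v), (∀ p : Momentum, ∀ j ≤ 2, ‖iteratedFDeriv ℝ j (frameShift Kx) p‖ ≤ A) →
        klAnisoFamily L M β μ Kx e₀ (k + 1) ω' kk ≠ 0 → klAnisoFamily L M β μ Kx e₀ k a' kk ≠ 0 →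
        ‖klFermiPoint μ Kx θ₂ - klFermiPoint μ Kx θ₁‖ ≤ ρa + ρb := by
      intro Kx hAx h1 h2
      refine (pi_norm_le_iff_of_nonneg (by positivity)).2 fun i => ?_
      have c1 := support_klAnisoFamily_cell B hAx hADt L M he β (k + 1) (hloN (k + 1)) (hhiN (k + 1)) ω' kk h1 i
      have c2 := support_klAnisoFamily_cell B hAx hADt L M he β k (hloN k) (hhiN k) a' kk h2 i
      rw [Real.norm_eq_abs, Pi.sub_apply]
      have e : klFermiPoint μ Kx θ₂ i - klFermiPoint μ Kx θ₁ i =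
          (c i - klFermiPoint μ Kx θ₁ i) - (c i - klFermiPoint μ Kx θ₂ i) := by ring
      rw [e]
      refine (abs_sub _ _).trans ?_
      rw [hρa, hρb] at *
      linarith only [c1, c2]
    by_cases hK' : klAnisoFamily L M β μ K' e₀ (k + 1) ω' kk * klAnisoFamily L M β μ K' e₀ k a' kk = 0
    · -- then the base-frame product is nonzero
      have hK : klAnisoFamily L M β μ K e₀ (k + 1) ω' kk * klAnisoFamily L M β μ K e₀ k a' kk ≠ 0 := by
        intro h0; apply hq; rw [hK', h0, sub_zero]
      obtain ⟨h1, h2⟩ := mul_ne_zero_iff.mp hK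
      have hs := hcellK K hA h1 h2
      have hf : ‖klFermiPoint μ K' θ₂ - klFermiPoint μ K θ₂‖ ≤ fd / (B.Dtmin - 2 * A) := by
        have h := norm_klFermiPoint_sub_le_frameDist B hA' hA hADt hlo' hhi' θ₂
        rw [frameDist_comm] at h
        exact h.trans hfd'
      calc ‖pF₂ - pF₁‖ = ‖(klFermiPoint μ K' θ₂ - klFermiPoint μ K θ₂) + (klFermiPoint μ K θ₂ - klFermiPoint μ K θ₁)‖ := by
            rw [hpF₂, hpF₁]; congr 1; abel
        _ ≤ ‖klFermiPoint μ K' θ₂ - klFermiPoint μ K θ₂‖ + ‖klFermiPoint μ K θ₂ - klFermiPoint μ K θ₁‖ := norm_add_le _ _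
        _ ≤ fd / (B.Dtmin - 2 * A) + (ρa + ρb) := add_le_add hf hs
        _ = ρa + ρb + fd / (B.Dtmin - 2 * A) := by ring
    · obtain ⟨h1, h2⟩ := mul_ne_zero_iff.mp hK'
      have hs := hcellK K' hA' h1 h2
      have hf : ‖klFermiPoint μ K' θ₁ - klFermiPoint μ K θ₁‖ ≤ fd / (B.Dtmin - 2 * A) := by
        have h := norm_klFermiPoint_sub_le_frameDist B hA' hA hADt hlo' hhi' θ₁
        rw [frameDist_comm] at h
        exact h.trans hfd'
      calc ‖pF₂ - pF₁‖ = ‖(klFermiPoint μ K' θ₂ - klFermiPoint μ K' θ₁) + (klFermiPoint μ K' θ₁ - klFermiPoint μ K θ₁)‖ := by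
            rw [hpF₂, hpF₁]; congr 1; abel
        _ ≤ ‖klFermiPoint μ K' θ₂ - klFermiPoint μ K' θ₁‖ + ‖klFermiPoint μ K' θ₁ - klFermiPoint μ K θ₁‖ := norm_add_le _ _
        _ ≤ (ρa + ρb) + fd / (B.Dtmin - 2 * A) := add_le_add hs hf
  -- the transported tangency of `e_K` at `p_F^{K′}(θ₂)`
  have h1 := abs_fderiv_frameLevel_toLp_le_of_near μ K hK₂ pF₁ pF₂ w htan hdist
  -- `e_{K′} = e_K − ν` on the Pi side
  have heq : eK' = fun p => eK p - ν p := by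
    funext p; rw [heK, heK', hν p]; ring
  have hdK : DifferentiableAt ℝ eK pF₂ := by
    have h := (contDiff_frameLevelPi (μ := μ) (K := K)).differentiable (by norm_num)
    exact (h pF₂)
  have hsplit : fderiv ℝ eK' pF₂ w = fderiv ℝ eK pF₂ w - fderiv ℝ ν pF₂ w := by
    have hF : HasFDerivAt (fun p => eK p - ν p) (fderiv ℝ eK pF₂ - fderiv ℝ ν pF₂) pF₂ :=
      hdK.hasFDerivAt.sub (hνd pF₂).hasFDerivAt
    rw [heq, hF.fderiv]; rfl
  have hEK : fderiv ℝ eK pF₂ w = fderiv ℝ (frameLevel μ K) (WithLp.toLp 2 pF₂) (WithLp.toLp 2 w) := fderiv_frameLevelPi_apply μ K pF₂ w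
  have hνb : |fderiv ℝ ν pF₂ w| ≤ G₁x * (|2 * π / (L : ℝ)| * (Nr + 1 / 2)) := by
    rw [← Real.norm_eq_abs]
    refine ((fderiv ℝ ν pF₂).le_opNorm w).trans ?_
    exact mul_le_mul (hN₁ pF₂) hwsup (norm_nonneg _) hG0
  have hD0 : 0 ≤ ρa + ρb + fd / (B.Dtmin - 2 * A) := (norm_nonneg _).trans hdist
  have hcurv : K₂ * (Real.sqrt 2 * (ρa + ρb + fd / (B.Dtmin - 2 * A))) * ‖(WithLp.toLp 2 w : EuclideanSpace ℝ (Fin 2))‖ ≤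
      K₂ * (Real.sqrt 2 * (ρa + ρb + fd / (B.Dtmin - 2 * A))) * (2 * π / L * (Real.sqrt 2 * (Nr + 1 / 2))) :=
    mul_le_mul_of_nonneg_left hwE (by positivity)
  have hs2 : Real.sqrt 2 * Real.sqrt 2 = 2 := by rw [← sq]; exact Real.sq_sqrt (by norm_num)
  calc |fderiv ℝ eK' pF₂ w| = |fderiv ℝ eK pF₂ w - fderiv ℝ ν pF₂ w| := by rw [hsplit]
    _ ≤ |fderiv ℝ eK pF₂ w| + |fderiv ℝ ν pF₂ w| := abs_sub _ _
    _ ≤ (|2 * π / (L : ℝ)| * (4 + 2 * A) + K₂ * (Real.sqrt 2 * (ρa + ρb + fd / (B.Dtmin - 2 * A))) * (2 * π / L * (Real.sqrt 2 * (Nr + 1 / 2)))) +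
          G₁x * (|2 * π / (L : ℝ)| * (Nr + 1 / 2)) := by
        rw [hEK]; exact add_le_add (h1.trans (add_le_add le_rfl hcurv)) hνb
    _ = |2 * π / (L : ℝ)| * ((4 + 2 * A) + (2 * K₂ * (ρa + ρb + fd / (B.Dtmin - 2 * A)) + G₁x) * (Nr + 1 / 2)) := by
        rw [habs]
        have e : K₂ * (Real.sqrt 2 * (ρa + ρb + fd / (B.Dtmin - 2 * A))) * (2 * π / L * (Real.sqrt 2 * (Nr + 1 / 2))) =
            2 * π / L * ((Real.sqrt 2 * Real.sqrt 2) * K₂ * (ρa + ρb + fd / (B.Dtmin - 2 * A)) * (Nr + 1 / 2)) := by ring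
        rw [e, hs2]; ring
    _ ≤ |2 * π / (L : ℝ)| * T₂ := by
        refine mul_le_mul_of_nonneg_left ?_ (abs_nonneg _)
        have e : ρa + ρb + fd / (B.Dtmin - 2 * A) = (klScale e₀ k + B.smax * B.Dtmin * (3 * sectorWidth k / 4)) / (B.Dtmin - 2 * A) +
            (klScale e₀ (k + 1) + B.smax * B.Dtmin * (3 * sectorWidth (k + 1) / 4)) / (B.Dtmin - 2 * A) + fd / (B.Dtmin - 2 * A) := by
          rw [hρa, hρb]
        rw [e]; exact hT₂

end Summit.HubbardSuperconductivity.HubbardSuperconductivity.Theorems.TorusFourierL2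

end
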